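/-
Copyright: the b2b-balaban T⁴-continuum CRUX team, row NE7b leaf lineage `t4-ne7b-formalise-leaf-01` (gen 87). Project licence.
-/
import Summits.QuantumFields.BalabanUV.T4Continuum.Spine.NE7b.BlockSectionDecaySideTwo

/-!
# THE GLOBAL DECAY PROFILE OF THE SIDE-2 ONE-SHOT SECTION ON `ℤ⁴`, BY VALUE, AT FULL KERNEL WEIGHT:
# `|H(p, y)| ≤ 1.005·(5∕7)^{|blk p − y|₁}` for ALL `p, y`, and `≤ 0.138·(5∕7)^{|blk p − y|₁}` off the home block (every `a > 0`; axioms = the trio)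
# (row NE7b, node U5c; `BlockSectionDecaySideTwo`'s pointwise Agmon letter + ONE more family of kernel-evaluated facts: the competitor's own profile
# `|φ(x)|·(7∕5)^{|blk x|₁} ≤ 1` on the home block, `≤ 0.1335` elsewhere — nine `decide +kernel` chunks; [folklore] + kernel computation)

Cell `pub-balaban`, sub-cell `t4`, spine estimate NE7b (`T4WeightBudget.RelWeightBound`; the cell's OWN estimate — NOT PRINTED in [Bałaban 1983–89], NOT
PROVED).  Crux-route work under `Spine/NE7b/` by a row leaf (`t4-ne7b-formalise-leaf-01` gen 87) under FREEZE (0)'s crux-prover clause; NOTHING of Bałaban's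
is named as a Lean object, valued or asserted; no `T4Continuum/Support` leaf typed; TWO computable `def`s (the site check and its slab loop — data-side, as in
file 1∕4; definition lane); zero `sorry`; NO `native_decide`.  Imports: `BlockSectionDecaySideTwo` (through it the four `BlockSectionRowSumKernel*` files).

WHY.  `BlockSectionDecaySideTwo.abs_kerH_le_of_far` gives the decay five blocks out (where the competitor vanishes); inside the competitor's support the
same pointwise letter `|H(q,0) − φ(q)| ≤ E·(5∕7)^{|blk q|₁}` (`E ≤ 0.00436`) turns the competitor's OWN profile into the section's: the kernel checks, site by
site on the `9⁴·16` support sites, `|φ| ≤ 1` on the home block and `|φ(x)|·(7∕5)^{|blk x|₁} ≤ 0.1335` on every other block (the maximum `0.13342…` is attained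
on the eight axis-neighbour blocks), whence ONE global letter `|H(p,y)| ≤ K·(5∕7)^{|blk p − y|₁}` with `K = 1.005` (home block included) and `K = 0.138` off it.

WHAT IS PROVED (d = 4, side 2, every `a > 0`):
* §1 [data + kernel computation] `siteOK` (the per-site check), `profRow i₀` (its loop over the slab `b₀ = −4 + i₀`), `profRow_0…8` (`decide +kernel`), `profRow_all`.
* §2 [folklore bookkeeping] `abs_phi_le_profile`: `|φ q| ≤ 1` if `blk 1 q = 0`, else `|φ q| ≤ (1335∕10000)·(5∕7)^{|blk 1 q|₁}`.
* §3 **`abs_kerH_col_zero_le_profile`** (`|kerH 1 a q 0| ≤ (1005∕1000)·(5∕7)^{|blk 1 q|₁}`, and `≤ (138∕1000)·(5∕7)^{|blk 1 q|₁}` when `blk 1 q ≠ 0`),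
  **`abs_kerH_le_profile`** (`|kerH 1 a p y| ≤ (1005∕1000)·(5∕7)^{Σ_μ|blk 1 p μ − y μ|}` for ALL `p, y`),
  **`abs_kerH_le_profile_off_home`** (`y ≠ blk 1 p → |kerH 1 a p y| ≤ (138∕1000)·(5∕7)^{Σ_μ|blk 1 p μ − y μ|}`).

HONEST: [folklore] + kernel computation (axioms ⊆ {propext, Classical.choice, Quot.sound}); a by-value profile of the FREE scalar side-2 block-mean skeleton on `ℤ⁴`
— NOT Bałaban's estimate, not the symbolic-rate letters of (46)–(48)∕(62); nothing of (A3) ∕ NC-NE7b-α; BY-NAME EFFECT ON THE WALL: NONE.  NE7b NOT PRINTED ∕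
NOT PROVED; spine PROVED 0∕9; rung (B)+1 on a FINITE torus — NOT infinite volume, NOT the mass gap, NOT Clay.  HONEST DEPENDENCY: continuum YM on T⁴ ⇐ BetaPertH ∧
nine spine estimates (0∕9 proved); BetaPertH ⇐ (D1) ∧ (D4) ∧ CAP+tail; G-an2-4 gates asym, D1 and NE2∕3∕4.
-/

set_option autoImplicit false

namespace Summit.QuantumFields.BalabanUV.T4Continuum.NE7b.BlockSectionDecayProfile

open Finset
open Literature.MathematicalPhysics.QuantumFieldTheory.Balaban1983to89
open B6QGQLower276 (X B e blk loc side mem_B side_mul_blk_add_loc loc_nonneg loc_le)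
open B5Hk103ScalarZd (kerH)
open B5Hk165TranslZd (bshift kerH_eq_col_zero)
open Summit.QuantumFields.BalabanUV.T4Continuum.NE7b.BlockSectionAgmonEngine (blk_sub_bshift)
open Summit.QuantumFields.BalabanUV.T4Continuum.NE7b.BlockSectionRowSumValue (rng mem_rng Sbox boxB)
open Summit.QuantumFields.BalabanUV.T4Continuum.NE7b.BlockSectionRowSumKernelData (phiZ4 phiZ phi)
open Summit.QuantumFields.BalabanUV.T4Continuum.NE7b.BlockSectionRowSumKernelFacts (phiZ_eq_zero)
open Summit.QuantumFields.BalabanUV.T4Continuum.NE7b.BlockSectionDecaySideTwo (abs_kerH_col_zero_sub_phi_le phi_eq_zero_of_far)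

/-! ## §1  The competitor's own profile, checked by the kernel [data + kernel computation] -/

/-- The per-site check at the site `2b + z` of the block `b`: `|φ_Z| ≤ 2⁴⁴` if `b = 0`, else `|φ_Z|·7^{|b|₁}·10⁴ ≤ 1335·2⁴⁴·5^{|b|₁}`
(`φ = φ_Z∕2⁴⁴`; i.e. `|φ|·(7∕5)^{|b|₁} ≤ 0.1335` off the home block). [data] -/
def siteOK (b₀ b₁ b₂ b₃ z₀ z₁ z₂ z₃ : ℤ) : Bool :=
  let v := |phiZ4 (2 * b₀ + z₀) (2 * b₁ + z₁) (2 * b₂ + z₂) (2 * b₃ + z₃)|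
  let m := b₀.natAbs + b₁.natAbs + b₂.natAbs + b₃.natAbs
  if b₀ = 0 ∧ b₁ = 0 ∧ b₂ = 0 ∧ b₃ = 0 then decide (v ≤ 2 ^ 44) else decide (v * (7 ^ m * 10000) ≤ 1335 * 2 ^ 44 * 5 ^ m)

/-- The site checks on one slab (`b₀ = −4 + i₀`) of the support blocks `[−4, 4]⁴`, all sixteen offsets. [data] -/
def profRow (i₀ : ℕ) : Bool :=
  (List.range 9).all fun i₁ : ℕ => (List.range 9).all fun i₂ : ℕ => (List.range 9).all fun i₃ : ℕ =>
    (List.range 2).all fun j₀ : ℕ => (List.range 2).all fun j₁ : ℕ => (List.range 2).all fun j₂ : ℕ => (List.range 2).all fun j₃ : ℕ =>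
      siteOK ((-4 : ℤ) + i₀) ((-4 : ℤ) + i₁) ((-4 : ℤ) + i₂) ((-4 : ℤ) + i₃) j₀ j₁ j₂ j₃

set_option maxHeartbeats 4000000 in
/-- Profile checks, slab `b₀ = −4`. [kernel computation] -/
theorem profRow_0 : profRow 0 = true := by
  decide +kernel

set_option maxHeartbeats 4000000 in
/-- Profile checks, slab `b₀ = −3`. [kernel computation] -/
theorem profRow_1 : profRow 1 = true := by
  decide +kernel

set_option maxHeartbeats 4000000 in
/-- Profile checks, slab `b₀ = −2`. [kernel computation] -/
theorem profRow_2 : profRow 2 = true := by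
  decide +kernel

set_option maxHeartbeats 4000000 in
/-- Profile checks, slab `b₀ = −1`. [kernel computation] -/
theorem profRow_3 : profRow 3 = true := by
  decide +kernel

set_option maxHeartbeats 4000000 in
/-- Profile checks, slab `b₀ = 0`. [kernel computation] -/
theorem profRow_4 : profRow 4 = true := by
  decide +kernel

set_option maxHeartbeats 4000000 in
/-- Profile checks, slab `b₀ = 1`. [kernel computation] -/
theorem profRow_5 : profRow 5 = true := by
  decide +kernel

set_option maxHeartbeats 4000000 in
/-- Profile checks, slab `b₀ = 2`. [kernel computation] -/
theorem profRow_6 : profRow 6 = true := by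
  decide +kernel

set_option maxHeartbeats 4000000 in
/-- Profile checks, slab `b₀ = 3`. [kernel computation] -/
theorem profRow_7 : profRow 7 = true := by
  decide +kernel

set_option maxHeartbeats 4000000 in
/-- Profile checks, slab `b₀ = 4`. [kernel computation] -/
theorem profRow_8 : profRow 8 = true := by
  decide +kernel

/-- All nine slabs. -/
theorem profRow_all (i₀ : ℕ) (h : i₀ < 9) : profRow i₀ = true := by
  interval_cases i₀
  exacts [profRow_0, profRow_1, profRow_2, profRow_3, profRow_4, profRow_5, profRow_6, profRow_7, profRow_8]

/-! ## §2  The competitor's profile as a real-valued letter [folklore bookkeeping] -/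

/-- **The competitor's profile**: `|φ q| ≤ 1` on the home block and `|φ q| ≤ (1335∕10000)·(5∕7)^{|blk 1 q|₁}` on every other block (and `0` off the support). -/
theorem abs_phi_le_profile (q : X 4) :
    |phi q| ≤ (if blk 1 q = 0 then (1 : ℝ) else 1335 / 10000 * ((5 : ℝ) / 7) ^ (∑ μ, ((blk 1 q) μ).natAbs)) := by
  classical
  have hs : side 1 = 2 := by simp [side]
  have hdec : ∀ μ : Fin 4, q μ = 2 * blk 1 q μ + loc 1 q μ := fun μ => by
    have h := side_mul_blk_add_loc 1 q μ; rw [hs] at h; linarith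
  have hl : ∀ μ : Fin 4, loc 1 q μ = 0 ∨ loc 1 q μ = 1 := fun μ => by
    have h0 := loc_nonneg 1 q μ
    have h1 : loc 1 q μ ≤ 1 := by have := loc_le 1 q μ; exact_mod_cast this
    omega
  by_cases hbox : ∀ μ : Fin 4, -4 ≤ blk 1 q μ ∧ blk 1 q μ ≤ 4
  · -- inside the support: read the kernel's site check at `(blk q, loc q)`
    have hi : ∀ μ : Fin 4, ∃ i : ℕ, i < 9 ∧ blk 1 q μ = -4 + i := fun μ => by
      have := hbox μ; exact ⟨(blk 1 q μ + 4).toNat, by omega, by omega⟩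
    have hj : ∀ μ : Fin 4, ∃ j : ℕ, j < 2 ∧ loc 1 q μ = j := fun μ => by
      rcases hl μ with h | h
      · exact ⟨0, by omega, by simp [h]⟩
      · exact ⟨1, by omega, by simp [h]⟩
    obtain ⟨i₀, hi₀, e₀⟩ := hi 0
    obtain ⟨i₁, hi₁, e₁⟩ := hi 1
    obtain ⟨i₂, hi₂, e₂⟩ := hi 2
    obtain ⟨i₃, hi₃, e₃⟩ := hi 3
    obtain ⟨j₀, hj₀, f₀⟩ := hj 0
    obtain ⟨j₁, hj₁, f₁⟩ := hj 1
    obtain ⟨j₂, hj₂, f₂⟩ := hj 2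
    obtain ⟨j₃, hj₃, f₃⟩ := hj 3
    have hrow := profRow_all i₀ hi₀
    simp only [profRow, List.all_eq_true, List.mem_range] at hrow
    have hsite := hrow i₁ hi₁ i₂ hi₂ i₃ hi₃ j₀ hj₀ j₁ hj₁ j₂ hj₂ j₃ hj₃
    -- the checked site is `q`
    have hq : phiZ q = phiZ4 (2 * ((-4 : ℤ) + i₀) + j₀) (2 * ((-4 : ℤ) + i₁) + j₁) (2 * ((-4 : ℤ) + i₂) + j₂) (2 * ((-4 : ℤ) + i₃) + j₃) := by
      simp only [phiZ]
      rw [hdec 0, hdec 1, hdec 2, hdec 3, e₀, e₁, e₂, e₃, f₀, f₁, f₂, f₃]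
    have hm : (∑ μ, ((blk 1 q) μ).natAbs) = ((-4 : ℤ) + i₀).natAbs + ((-4 : ℤ) + i₁).natAbs + ((-4 : ℤ) + i₂).natAbs + ((-4 : ℤ) + i₃).natAbs := by
      rw [Fin.sum_univ_four, e₀, e₁, e₂, e₃]
    have hb0 : (blk 1 q = 0) ↔ ((-4 : ℤ) + i₀ = 0 ∧ (-4 : ℤ) + i₁ = 0 ∧ (-4 : ℤ) + i₂ = 0 ∧ (-4 : ℤ) + i₃ = 0) := by
      constructor
      · intro h
        have h0 := congr_fun h 0; have h1 := congr_fun h 1; have h2 := congr_fun h 2; have h3 := congr_fun h 3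
        simp only [Pi.zero_apply] at h0 h1 h2 h3
        exact ⟨by rw [← e₀, h0], by rw [← e₁, h1], by rw [← e₂, h2], by rw [← e₃, h3]⟩
      · rintro ⟨h0, h1, h2, h3⟩
        funext μ; fin_cases μ
        · exact e₀.trans h0
        · exact e₁.trans h1
        · exact e₂.trans h2
        · exact e₃.trans h3
    simp only [siteOK] at hsite
    have h2pos : (0 : ℝ) < 2 ^ 44 := by positivity
    have habs : |phi q| = |(phiZ q : ℝ)| / 2 ^ 44 := by
      rw [phi, abs_div, abs_of_pos h2pos]
    rw [habs, hq]
    by_cases h0 : (-4 : ℤ) + i₀ = 0 ∧ (-4 : ℤ) + i₁ = 0 ∧ (-4 : ℤ) + i₂ = 0 ∧ (-4 : ℤ) + i₃ = 0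
    · rw [if_pos h0, decide_eq_true_eq] at hsite
      rw [if_pos (hb0.2 h0), div_le_one h2pos]
      exact_mod_cast hsite
    · rw [if_neg h0, decide_eq_true_eq] at hsite
      rw [if_neg (fun h => h0 (hb0.1 h)), hm]
      set m : ℕ := ((-4 : ℤ) + i₀).natAbs + ((-4 : ℤ) + i₁).natAbs + ((-4 : ℤ) + i₂).natAbs + ((-4 : ℤ) + i₃).natAbs with hm_def
      have hR : |((phiZ4 (2 * ((-4 : ℤ) + i₀) + j₀) (2 * ((-4 : ℤ) + i₁) + j₁) (2 * ((-4 : ℤ) + i₂) + j₂) (2 * ((-4 : ℤ) + i₃) + j₃) : ℤ) : ℝ)| *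
          (7 ^ m * 10000) ≤ 1335 * 2 ^ 44 * 5 ^ m := by exact_mod_cast hsite
      have h7 : (0 : ℝ) < 7 ^ m * 10000 := by positivity
      rw [div_le_iff₀ h2pos]
      calc |((phiZ4 (2 * ((-4 : ℤ) + i₀) + j₀) (2 * ((-4 : ℤ) + i₁) + j₁) (2 * ((-4 : ℤ) + i₂) + j₂) (2 * ((-4 : ℤ) + i₃) + j₃) : ℤ) : ℝ)|
          ≤ (1335 * 2 ^ 44 * 5 ^ m) / (7 ^ m * 10000) := (le_div_iff₀ h7).2 hR
        _ = 1335 / 10000 * ((5 : ℝ) / 7) ^ m * 2 ^ 44 := by rw [div_pow]; ring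
  · -- outside the support the competitor vanishes
    have hout : ¬ (∀ μ : Fin 4, -8 ≤ q μ ∧ q μ ≤ 9) := by
      intro hall
      apply hbox
      intro μ
      have h := hall μ
      rw [hdec μ] at h
      rcases hl μ with h0 | h0 <;> rw [h0] at h <;> omega
    have hz : phi q = 0 := by simp [phi, phiZ_eq_zero hout]
    rw [hz, abs_zero]
    split_ifs <;> positivity

/-! ## §3  The section's profile [folklore + kernel computation] -/

/-- **THE COLUMN PROFILE**: for every fine site `q`, `|kerH 1 a q 0| ≤ (1005∕1000)·(5∕7)^{|blk 1 q|₁}`, and `≤ (138∕1000)·(5∕7)^{|blk 1 q|₁}` when `blk 1 q ≠ 0`. -/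
theorem abs_kerH_col_zero_le_profile {a : ℝ} (ha : 0 < a) (q : X 4) :
    |kerH 1 a q 0| ≤ 1005 / 1000 * ((5 : ℝ) / 7) ^ (∑ μ, ((blk 1 q) μ).natAbs) ∧
      (blk 1 q ≠ 0 → |kerH 1 a q 0| ≤ 138 / 1000 * ((5 : ℝ) / 7) ^ (∑ μ, ((blk 1 q) μ).natAbs)) := by
  have hE := abs_kerH_col_zero_sub_phi_le ha q
  have hφ := abs_phi_le_profile q
  have htri : |kerH 1 a q 0| ≤ |kerH 1 a q 0 - phi q| + |phi q| := by
    have := abs_add_le (kerH 1 a q 0 - phi q) (phi q); rwa [sub_add_cancel] at this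
  have hpow : (0 : ℝ) ≤ ((5 : ℝ) / 7) ^ (∑ μ, ((blk 1 q) μ).natAbs) := by positivity
  have hEle : ((206992365267364500521373518 : ℝ) / ((5 : ℝ) ^ 20 * 2 ^ 48)) / (62 / 35) ≤ 436 / 100000 := by norm_num
  have hE' : |kerH 1 a q 0 - phi q| ≤ 436 / 100000 * ((5 : ℝ) / 7) ^ (∑ μ, ((blk 1 q) μ).natAbs) := by
    refine hE.trans ?_; rw [mul_comm]; exact mul_le_mul_of_nonneg_right hEle hpow
  constructor
  · by_cases h0 : blk 1 q = 0
    · rw [if_pos h0] at hφ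
      have hm : (∑ μ, ((blk 1 q) μ).natAbs) = 0 := by rw [h0]; simp
      rw [hm, pow_zero] at hE' ⊢
      linarith
    · rw [if_neg h0] at hφ
      nlinarith
  · intro h0
    rw [if_neg h0] at hφ
    nlinarith

/-- **THE GLOBAL DECAY PROFILE BY VALUE**: for ALL `p`, `y` and every `a > 0`, `|kerH 1 a p y| ≤ (1005∕1000)·(5∕7)^{Σ_μ |blk 1 p μ − y μ|}` —
rate `log(7∕5)` per block in `ℓ¹` distance from the home block, prefactor `1.005` (the home value is `1`). Axioms = the trio. [folklore + kernel computation] -/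
theorem abs_kerH_le_profile {a : ℝ} (ha : 0 < a) (p y : X 4) :
    |kerH 1 a p y| ≤ 1005 / 1000 * ((5 : ℝ) / 7) ^ (∑ μ, (blk 1 p μ - y μ).natAbs) := by
  rw [kerH_eq_col_zero 1 ha p y]
  have h := (abs_kerH_col_zero_le_profile ha (p - bshift 1 y)).1
  rw [blk_sub_bshift] at h
  exact h

/-- **OFF THE HOME BLOCK**: `y ≠ blk 1 p → |kerH 1 a p y| ≤ (138∕1000)·(5∕7)^{Σ_μ |blk 1 p μ − y μ|}` (the maximum `0.1334` of the competitor's weighted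
profile sits on the axis neighbours; `+ 0.0044` of certificate slack). [folklore + kernel computation] -/
theorem abs_kerH_le_profile_off_home {a : ℝ} (ha : 0 < a) (p y : X 4) (hy : y ≠ blk 1 p) :
    |kerH 1 a p y| ≤ 138 / 1000 * ((5 : ℝ) / 7) ^ (∑ μ, (blk 1 p μ - y μ).natAbs) := by
  rw [kerH_eq_col_zero 1 ha p y]
  have h := (abs_kerH_col_zero_le_profile ha (p - bshift 1 y)).2
  rw [blk_sub_bshift] at h
  exact h (fun h0 => hy (sub_eq_zero.1 h0).symm)

/-- Toy: one block off home the bound is `0.138·5∕7 < 0.099`; the true axis-neighbour value of CERT-1's competitor is `0.0953…`. -/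
example : (138 : ℝ) / 1000 * (5 / 7) < 99 / 1000 := by norm_num

end Summit.QuantumFields.BalabanUV.T4Continuum.NE7b.BlockSectionDecayProfile
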